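import Summits.QuantumFields.YangMills.Theorems.ForcedResponseSkewnessResponseLocalisationFarCollar
import HarnessLib

/-!
# Crux `ResponseLocalisation` (stmt-QuantumFields-24293), far stub `Repair.stub_far : FarSigR`:
# «collar first, cluster second» — the third cumulant at a far site from the femto boundary law and a clustering bound

Support file (`--supports stmt-QuantumFields-24293 --as helper`) of the width prover `ym-line-frs-p2` (lead `ym-line-frs-p1`), route
`ForcedResponseSkewness`; sequel of `…ResponseLocalisationFarCollar` (`torusK3_eq_torusE_collar`: `κ₃ = E_T[h_x h_y h_z]`, `‖h_w‖ ≤ 2C₁/R⁴`).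
Here the second half of the decomposition recorded in the item's evidence note `evidence-24293-far-IR.md` (diagnosis concurred by the
owner ym-idea-3 and the lead, HOME INBOX 2026-08-28T02:20/02:26Z; the far clause is being moved into the route's declared residual):

* §1 torus-distance bookkeeping: `abs_valMinAbs_sub_le` (the cyclic representative is 1-Lipschitz under integer shifts) and the passage
  from site separation to separation of the collar supports (`sep_collarSupport`).
* §2 `abs_torusK3_le_of_collar_cluster` — at ONE coupling and ONE torus: a femto boundary law for the action density at `β` (the `FBL`
  clause at `β`) and a CLUSTERING INEQUALITY for bounded cylinder observables whose supports are torus-separated by `n` in one coordinate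
  (taken as an explicit hypothesis at `(β, L)` — gap-class, NOT proved, NOT a registered stub of this line) give, for three sites with
  pairwise torus sup-separation `≥ 2R+4` and the far site `x` separated by `n + 2R + 4` from `y` and from `z` in a common coordinate,
  `|torusK3_{β,L}(x,y,z)| ≤ K·(2C₁/R⁴)³·e^{−m·aβ·n}` — hyperscaling smallness `(2C₁/R⁴)³` from the collars, decay from the clustering of
  `Cov_T(h_x, h_y h_z)` (`E_T h_x = 0`).

Honest label: bookkeeping toward ONE stub of a CONDITIONAL rung line (leaf R2a `BalabanLadder.NT`) under an IR (gap-class) hypothesis; no stub,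
crux, NT or Yang–Mills mass-gap claim is proved here.
-/

set_option autoImplicit false

noncomputable section

open MeasureTheory Filter Topology
open Literature.MathematicalPhysics.QuantumFieldTheory Literature.MathematicalPhysics.QuantumLattice
open Literature.Probability.LatticeModels
open Summit.QuantumFields.YangMills.Cruxes.OSLegsFromFemtoAndGap.DlrCollarTransfer

namespace Summit.QuantumFields.YangMills.Cruxes.ResponseLocalisation.Far

/-! ## §1 Torus separation of the collar supports -/

/-- **The cyclic representative is 1-Lipschitz under integer shifts**: `|valMinAbs t| ≤ |valMinAbs (t + δ)| + |δ|` modulo `2L+1`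
(minimality of `valMinAbs` among the representatives of its class, `ZMod.natAbs_min_of_le_div_two`). [folklore] -/
theorem abs_valMinAbs_sub_le (L : ℕ) (t δ : ℤ) :
    |((((t : ℤ) : ZMod (2 * L + 1))).valMinAbs : ℤ)| ≤
      |((((t + δ : ℤ) : ZMod (2 * L + 1))).valMinAbs : ℤ)| + |δ| := by
  haveI : NeZero (2 * L + 1) := ⟨by omega⟩
  set xv : ℤ := (((t : ℤ) : ZMod (2 * L + 1))).valMinAbs with hxv
  set yv : ℤ := (((t + δ : ℤ) : ZMod (2 * L + 1))).valMinAbs - δ with hyv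
  have he : ((xv : ℤ) : ZMod (2 * L + 1)) = ((yv : ℤ) : ZMod (2 * L + 1)) := by
    rw [hxv, hyv]
    push_cast [ZMod.coe_valMinAbs]
    ring
  have hl : xv.natAbs ≤ (2 * L + 1) / 2 := ZMod.natAbs_valMinAbs_le _
  have hmin := ZMod.natAbs_min_of_le_div_two (2 * L + 1) xv yv he hl
  have h1 : |xv| ≤ |yv| := by
    rw [Int.abs_eq_natAbs, Int.abs_eq_natAbs]
    exact_mod_cast hmin
  calc |xv| ≤ |yv| := h1
    _ = |(((t + δ : ℤ) : ZMod (2 * L + 1))).valMinAbs - δ| := by rw [hyv]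
    _ ≤ |((((t + δ : ℤ) : ZMod (2 * L + 1))).valMinAbs : ℤ)| + |δ| := abs_sub _ _

/-- **From site separation to support separation.**  If `|valMinAbs(x_k − y_k)| ≥ n + 2R + 4` and the sites `u, w` are within
sup-distance `R+2` of `x` resp. `y` in coordinate `k`, then `|valMinAbs(u_k − w_k)| ≥ n`. [folklore] -/
theorem le_abs_valMinAbs_of_near (L : ℕ) {R n : ℕ} {x y u w : Fin 4 → ℤ} {k : Fin 4}
    (hsep : (n : ℤ) + 2 * R + 4 ≤ |((((x k - y k : ℤ) : ZMod (2 * L + 1))).valMinAbs : ℤ)|)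
    (hu : |u k - x k| ≤ (R : ℤ) + 2) (hw : |w k - y k| ≤ (R : ℤ) + 2) :
    (n : ℤ) ≤ |((((u k - w k : ℤ) : ZMod (2 * L + 1))).valMinAbs : ℤ)| := by
  -- `x_k − y_k = (u_k − w_k) + δ` with `|δ| ≤ 2R+4`
  have key := abs_valMinAbs_sub_le L (u k - w k) ((x k - y k) - (u k - w k))
  have e1 : u k - w k + (x k - y k - (u k - w k)) = x k - y k := by ring
  rw [e1] at key
  have hδ : |x k - y k - (u k - w k)| ≤ 2 * (R : ℤ) + 4 := by
    have e2 : x k - y k - (u k - w k) = (w k - y k) - (u k - x k) := by ring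
    rw [e2]
    calc |w k - y k - (u k - x k)| ≤ |w k - y k| + |u k - x k| := abs_sub _ _
      _ ≤ (R + 2) + (R + 2) := add_le_add hw hu
      _ = 2 * (R : ℤ) + 4 := by ring
  -- `|vma(x−y)| ≤ |vma(u−w)| + |δ|`: need the Lipschitz lemma the other way round
  have key' := abs_valMinAbs_sub_le L (x k - y k) ((u k - w k) - (x k - y k))
  have e3 : x k - y k + (u k - w k - (x k - y k)) = u k - w k := by ring
  rw [e3] at key'
  have hδ' : |u k - w k - (x k - y k)| ≤ 2 * (R : ℤ) + 4 := by
    rw [abs_sub_comm]; exact hδ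
  linarith

section Cluster

variable (G : Type) [Group G] [TopologicalSpace G] [IsTopologicalGroup G] [CompactSpace G]
  [MeasurableSpace G] [BorelSpace G] (r : LatticeRep G)

/-- The torus mean of the collared density vanishes: `E_T[γ_{B_x}(dens_x) − E_T dens_x] = 0` (DLR with trivial far factor).
[folklore] -/
theorem torusE_collar_eq_zero (β : ℝ) {L R : ℕ} (hR : 1 ≤ R) (hRL : 4 * R + 8 ≤ L) (x : Fin 4 → ℤ) :
    torusE G r β L (fun η => kerE G r β (fun k => x k - (R + 1)) (2 * R + 3) η (dens G r x) - torusE G r β L (dens G r x)) =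
      0 := by
  haveI : SecondCountableTopology G :=
    (r.continuous.isClosedEmbedding r.injective).isEmbedding.secondCountableTopology
  haveI := isProbabilityMeasure_wilsonMeasure (d := 4) (L := 2 * L + 1) r.ρ r.continuous β
  obtain ⟨CA, hCA⟩ := r.curvature.bounded
  have hgc : Continuous fun ζ => kerE G r β (fun k => x k - (R + 1)) (2 * R + 3) ζ (dens G r x) := by
    unfold kerE
    exact continuous_integral_ymSpecification r.ρ r.continuous β _ (continuous_dens r x) (fun U => hCA _)
  have hgb : ∀ ζ, |kerE G r β (fun k => x k - (R + 1)) (2 * R + 3) ζ (dens G r x)| ≤ CA := fun ζ => by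
    unfold kerE
    exact abs_integral_ymSpecification_le r.ρ r.continuous β _ (fun U => hCA _) ζ
  have h1 : torusE G r β L (fun η => kerE G r β (fun k => x k - (R + 1)) (2 * R + 3) η (dens G r x) -
      torusE G r β L (dens G r x)) =
      torusE G r β L (fun η => kerE G r β (fun k => x k - (R + 1)) (2 * R + 3) η (dens G r x)) -
        torusE G r β L (dens G r x) := by
    unfold torusE
    exact integral_sub_const_of_abs_le (μ := wilsonMeasure (d := 4) (L := 2 * L + 1) r.ρ β)
      (f := fun U => kerE G r β (fun k => x k - (R + 1)) (2 * R + 3) (torusLift (2 * L + 1) U) (dens G r x))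
      (by exact (hgc.comp (continuous_torusLift _)).measurable) (fun U => hgb _) _
  rw [h1, ← torusE_dens_eq_torusE_kerE_centred G r β hR hRL x, sub_self]

/-! ## §2 The third cumulant at a far site: collars, then clustering -/

/-- **Collar first, cluster second.**  At one coupling `β` and one odd torus `(ℤ/(2L+1))⁴`, assume (i) the femto boundary law for the
action density at `β` (kernel means at depth `d ≥ 2` in cubes of side `b·aβ ≤ ℓ₁` within `C₁/d⁴` of `p`, every exterior) and (ii) a
CLUSTERING INEQUALITY at `(β, L)`: for bounded continuous cylinder observables `P, Q` of `ℤ⁴` read through the periodic lift whose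
supports are torus-separated by `n` in some coordinate, `|E_T[PQ] − E_T P·E_T Q| ≤ K‖P‖_∞‖Q‖_∞ e^{−m·aβ·n}` (gap-class hypothesis, NOT
proved).  Then for sites `x, y, z` at pairwise torus sup-separation `≥ 2R+4` (`1 ≤ R`, `(2R+3)·aβ ≤ ℓ₁`, `4R+8 ≤ L`) with `x` separated
by `≥ n + 2R + 4` from `y` AND from `z` in ONE coordinate `k`:
`|torusK3_{β,L}(x,y,z)| ≤ K·(2C₁/R⁴)³·e^{−m·aβ·n}` — the collar identity `κ₃ = E_T[h_x·(h_y h_z)]` (`…FarCollar`), `E_T h_x = 0`,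
`‖h_x‖ ≤ 2C₁/R⁴`, `‖h_y h_z‖ ≤ (2C₁/R⁴)²`, supports of the collars within sup-distance `R+2` of their sites. [folklore] -/
theorem abs_torusK3_le_of_collar_cluster (β : ℝ) {aβ C₁ ℓ₁ p : ℝ} (hC₁ : 0 ≤ C₁)
    (hF : ∀ (c : Fin 4 → ℤ) (b : ℕ), (b : ℝ) * aβ ≤ ℓ₁ → ∀ (η : LGConfig 4 G) (w : Fin 4 → ℤ),
      2 ≤ depth c b w → |kerE G r β c b η (dens G r w) - p| ≤ C₁ / (depth c b w : ℝ) ^ 4)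
    {L R : ℕ} (hR : 1 ≤ R) (hb : ((2 * R + 3 : ℕ) : ℝ) * aβ ≤ ℓ₁) (hRL : 4 * R + 8 ≤ L)
    {m K : ℝ}
    (hCl : ∀ (P Q : LGConfig 4 G → ℝ) (SP SQ : Finset (Literature.MathematicalPhysics.QuantumLattice.ZdEdge 4))
      (CP CQ : ℝ), Continuous P → Continuous Q → IsCylinder P SP → IsCylinder Q SQ →
      (∀ U, |P U| ≤ CP) → (∀ U, |Q U| ≤ CQ) → ∀ (k : Fin 4) (n : ℕ),
      (∀ e ∈ SP, ∀ e' ∈ SQ, (n : ℤ) ≤ |((((e.1 k - e'.1 k : ℤ) : ZMod (2 * L + 1))).valMinAbs : ℤ)|) →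
      |torusE G r β L (fun U => P U * Q U) - torusE G r β L P * torusE G r β L Q| ≤
        K * CP * CQ * Real.exp (-(m * aβ * n)))
    (x y z : Fin 4 → ℤ)
    (hxy : ∃ k : Fin 4, (2 * (R : ℤ) + 4) ≤ |((((x k - y k : ℤ) : ZMod (2 * L + 1))).valMinAbs : ℤ)|)
    (hxz : ∃ k : Fin 4, (2 * (R : ℤ) + 4) ≤ |((((x k - z k : ℤ) : ZMod (2 * L + 1))).valMinAbs : ℤ)|)
    (hyz : ∃ k : Fin 4, (2 * (R : ℤ) + 4) ≤ |((((y k - z k : ℤ) : ZMod (2 * L + 1))).valMinAbs : ℤ)|)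
    (k : Fin 4) (n : ℕ)
    (hnxy : (n : ℤ) + 2 * R + 4 ≤ |((((x k - y k : ℤ) : ZMod (2 * L + 1))).valMinAbs : ℤ)|)
    (hnxz : (n : ℤ) + 2 * R + 4 ≤ |((((x k - z k : ℤ) : ZMod (2 * L + 1))).valMinAbs : ℤ)|) :
    |torusK3 G r β L x y z| ≤ K * (2 * C₁ / (R : ℝ) ^ 4) ^ 3 * Real.exp (-(m * aβ * n)) := by
  -- the three collars
  set hx : LGConfig 4 G → ℝ := fun η =>
    kerE G r β (fun k => x k - (R + 1)) (2 * R + 3) η (dens G r x) - torusE G r β L (dens G r x) with hhx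
  set hy : LGConfig 4 G → ℝ := fun η =>
    kerE G r β (fun k => y k - (R + 1)) (2 * R + 3) η (dens G r y) - torusE G r β L (dens G r y) with hhy
  set hz : LGConfig 4 G → ℝ := fun η =>
    kerE G r β (fun k => z k - (R + 1)) (2 * R + 3) η (dens G r z) - torusE G r β L (dens G r z) with hhz
  set ε : ℝ := 2 * C₁ / (R : ℝ) ^ 4 with hε
  have hε0 : 0 ≤ ε := by positivity
  have hbx : ∀ η, |hx η| ≤ ε := fun η => abs_collar_le G r β hC₁ hF hR hb hRL x η
  have hby : ∀ η, |hy η| ≤ ε := fun η => abs_collar_le G r β hC₁ hF hR hb hRL y η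
  have hbz : ∀ η, |hz η| ≤ ε := fun η => abs_collar_le G r β hC₁ hF hR hb hRL z η
  -- the identity `κ₃ = E_T[h_x · (h_y h_z)]`
  have hid : torusK3 G r β L x y z = torusE G r β L (fun η => hx η * (hy η * hz η)) := by
    rw [torusK3_eq_torusE_collar G r β hR hRL x y z hxy hxz hyz]
    simp only [hhx, hhy, hhz, mul_assoc]
  -- supports and regularity
  set SX := cubeEdges (fun k => x k - (R + 1)) (2 * R + 3) ∪
    (plaquettesTouching (cubeEdges (fun k => x k - (R + 1)) (2 * R + 3))).biUnion plaquetteEdges with hSX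
  set SY := cubeEdges (fun k => y k - (R + 1)) (2 * R + 3) ∪
    (plaquettesTouching (cubeEdges (fun k => y k - (R + 1)) (2 * R + 3))).biUnion plaquetteEdges with hSY
  set SZ := cubeEdges (fun k => z k - (R + 1)) (2 * R + 3) ∪
    (plaquettesTouching (cubeEdges (fun k => z k - (R + 1)) (2 * R + 3))).biUnion plaquetteEdges with hSZ
  have hcx : IsCylinder hx SX := isCylinder_collar G r β L R hR x
  have hcy : IsCylinder hy SY := isCylinder_collar G r β L R hR y
  have hcz : IsCylinder hz SZ := isCylinder_collar G r β L R hR z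
  have hcyz : IsCylinder (fun η => hy η * hz η) (SY ∪ SZ) := by
    intro U V hUV
    have h1 : hy U = hy V := hcy fun e he => hUV e (by
      rw [Finset.coe_union]; exact Set.mem_union_left _ he)
    have h2 : hz U = hz V := hcz fun e he => hUV e (by
      rw [Finset.coe_union]; exact Set.mem_union_right _ he)
    simp only [h1, h2]
  have hPc : Continuous hx := continuous_collar G r β L R x
  have hQc : Continuous fun η => hy η * hz η := (continuous_collar G r β L R y).mul (continuous_collar G r β L R z)
  have hQb : ∀ η, |hy η * hz η| ≤ ε * ε := fun η => by
    rw [abs_mul]; exact mul_le_mul (hby η) (hbz η) (abs_nonneg _) hε0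
  -- separation of the supports in coordinate `k`
  have hsep : ∀ e ∈ SX, ∀ e' ∈ SY ∪ SZ,
      (n : ℤ) ≤ |((((e.1 k - e'.1 k : ℤ) : ZMod (2 * L + 1))).valMinAbs : ℤ)| := by
    intro e he e' he'
    have hu : |e.1 k - x k| ≤ (R : ℤ) + 2 := near_of_mem_collarSupport he k
    rcases Finset.mem_union.1 he' with h' | h'
    · exact le_abs_valMinAbs_of_near L hnxy hu (near_of_mem_collarSupport h' k)
    · exact le_abs_valMinAbs_of_near L hnxz hu (near_of_mem_collarSupport h' k)
  -- clustering, and `E_T h_x = 0`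
  have hcl := hCl hx (fun η => hy η * hz η) SX (SY ∪ SZ) ε (ε * ε) hPc hQc hcx hcyz hbx hQb k n hsep
  have h0 : torusE G r β L hx = 0 := torusE_collar_eq_zero G r β hR hRL x
  rw [h0, zero_mul, sub_zero] at hcl
  rw [hid]
  calc |torusE G r β L (fun η => hx η * (hy η * hz η))| ≤ K * ε * (ε * ε) * Real.exp (-(m * aβ * n)) := hcl
    _ = K * ε ^ 3 * Real.exp (-(m * aβ * n)) := by ring

end Cluster

end Summit.QuantumFields.YangMills.Cruxes.ResponseLocalisation.Far

end
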